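import Summits.CriticalPhenomena.CardyFormulaZ2.Theses.CardySelfRefinement
import Summits.CriticalPhenomena.CardyFormulaZ2.Theorems.CardySelfRefinementLagHandOffNoTraceArms
import Literature.Probability.RandomPlanarGeometry.PlanarDomainsTopology
import Literature.Probability.Percolation.InterfaceCurves
import HarnessLib

/-!
# No boundary tracing for line `hitting-tournament` of crux `LagHandOff`
(stmt-CriticalPhenomena-10268), part 2/3: fixed interior arc points are a.s. off the limit curve

Helper for the registered stub `stub_limitCurveRegularity` (conjunct (2), a.s. no boundary
tracing) of namespace `Summit.CriticalPhenomena.CardyFormulaZ2.Cruxes.LagHandOff.HittingTournament`;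
this part proves the registered sub-stub `stub_noTrace_fixedPoint`
(= `measure_boundary_mem_range_eq_zero`): along positive meshes `δₙ → 0`, if the interface laws
of an admissible `ℤ²`-discretisation family of `(D; a, b)` converge weakly to `ν`, then for
`z = D.boundary t₀` with `t₀` strictly inside the parameter interval of one of the two arcs,
`ν {γ | z ∈ trace γ} = 0`.

ONE-ARM BOUND: `z` is at distance `r > 0` from the other arc and from `a, b`
(`MarkedDomain.exists_pos_forall_mem_arc_of_dist_lt`).  For all small meshes and EVERY
configuration (`eventually_arm_of_visit`, from part 1's `arm_of_visit` and the Hausdorff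
convergence of the arcs / marked points of the data, `ZdDiscretisationFamily`), a visit of the
exploration polygon to `B̄(z, 2ε)` forces an open arm of `ω` across `A(z; 2ε + δ, r/8 - δ)` or a
closed one across `A(z; 2ε + 3δ, r/8 - 3δ)`, of probability `≤ 2 (32ε/r)^α` by the RSW one-arm
bounds `annulusOpenCrossing_half_le_holds` / `annulusDualCrossing_half_le_holds`.  LIMIT: the
bound passes to `ν {infDist z (trace ·) ≤ ε}` through the bounded continuous cut-off
`min 1 (max 0 ((2ε - infDist z (trace γ))/ε))` (the trace is `1`-Lipschitz for the Hausdorff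
distance, `infDist_range_le_add_dist`), and `ε → 0`.

References: M. Aizenman, A. Burchard, Duke Math. J. 99 (1999), App. A; F. Camia, C. M. Newman,
PTRF 139 (2007) §2 (boundary touching); G. Grimmett, *Percolation* (1999) §11.8 (one-arm decay at
`p = 1/2`).
-/

noncomputable section

open MeasureTheory Filter Set Topology Metric
open scoped unitInterval BoundedContinuousFunction
open Literature.Probability.Percolation Literature.Probability.LatticeModels
open Literature.Probability.RandomPlanarGeometry

namespace Summit.CriticalPhenomena.CardyFormulaZ2.Cruxes.LagHandOff.HittingTournament

/-! ### One visit near an interior point of a boundary arc forces an arm (family form) -/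

section Family

/-- **One visit near a boundary point forces an arm, along a discretisation family.** For a
`ℤ²`-discretisation family of `(D; a, b)` and a boundary point `z` at distance `≥ r` from both
marked points and from a nonempty set `K` to which one of the two continuous arcs of the data
converges: for all small meshes `δ` and every configuration whose exploration polygon visits
`B̄(z, ρ')` (`2ρ' ≤ r/8`), `ω` has an open arm in `A(z; ρ' + δ, r/8 - δ)` or a closed arm in
`A(z; ρ' + 3δ, r/8 - 3δ)`. -/
theorem eventually_arm_of_visit_core (D : DobrushinDomain) {E : ℝ → DiscreteDobrushin}
    (hE : ZdDiscretisationFamily D E) {z : ℂ} (hzf : z ∈ frontier D.carrier) {r : ℝ}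
    (hr : 0 < r) (hpt : ∀ k : Fin 2, r ≤ dist (D.pt k) z) {K : Set ℂ} (hK : K.Nonempty)
    (hKfar : ∀ w ∈ K, r ≤ dist w z)
    (hside : Tendsto (fun δ => hausdorffEDist (E δ).arcA K) (𝓝[>] 0) (𝓝 0) ∨
      Tendsto (fun δ => hausdorffEDist (E δ).arcB K) (𝓝[>] 0) (𝓝 0))
    {ρ' : ℝ} (hρ'r : 2 * ρ' ≤ r / 8) :
    ∀ᶠ δ in 𝓝[>] (0 : ℝ), ∀ ω : BondConfig (Site 2),
      (∃ u, dist (medialExplorationCurve (E δ) ω u) z ≤ ρ') →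
        ω ∈ annulusOpenCrossing z δ (ρ' + δ) (r / 8 - δ) ∨
          dualConfig ω ∈ annulusOpenCrossing z δ (ρ' + 3 * δ) (r / 8 - 3 * δ) := by
  have hH0 : (0 : ENNReal) < ENNReal.ofReal (r / 4) := ENNReal.ofReal_pos.2 (by positivity)
  have h1 := hE.eventually_isZdAdmissible
  have h2 : ∀ᶠ δ in 𝓝[>] (0 : ℝ), hausdorffEDist (medialPoint δ '' (E δ).zdABEdges)
      {D.pt 0, D.pt 1} < ENNReal.ofReal (r / 4) :=
    hE.tendsto_zdABEdges.eventually (Iio_mem_nhds hH0)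
  have h3 : ∀ᶠ δ in 𝓝[>] (0 : ℝ), hausdorffEDist (E δ).arcA K < ENNReal.ofReal (r / 4) ∨
      hausdorffEDist (E δ).arcB K < ENNReal.ofReal (r / 4) := by
    rcases hside with h | h
    · exact (h.eventually (Iio_mem_nhds hH0)).mono fun δ hδ => Or.inl hδ
    · exact (h.eventually (Iio_mem_nhds hH0)).mono fun δ hδ => Or.inr hδ
  have h4 : ∀ᶠ δ in 𝓝[>] (0 : ℝ), δ ≤ r / 64 :=
    mem_nhdsWithin_of_mem_nhds (Iic_mem_nhds (by positivity))
  filter_upwards [h1, h2, h3, h4] with δ hadm hAB hH hδr ω hvisit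
  have hδeq : (E δ).δ = δ := hE.δ_eq δ
  have hΩ : (E δ).Ω = D.carrier := hE.Ω_eq δ
  have hends : ∀ p ∈ medialPoint (E δ).δ '' (E δ).zdABEdges, 3 * r / 4 ≤ dist p z := by
    intro p hp
    rw [hδeq] at hp
    obtain ⟨w, hw, hpw⟩ := exists_edist_lt_of_hausdorffEDist_lt hp hAB
    rw [edist_lt_ofReal] at hpw
    have hwz : r ≤ dist w z := by
      simp only [mem_insert_iff, mem_singleton_iff] at hw
      rcases hw with rfl | rfl
      · exact hpt 0
      · exact hpt 1
    linarith [dist_triangle w p z, dist_comm p w]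
  have hzf' : z ∈ frontier (E δ).Ω := by rw [hΩ]; exact hzf
  have hKfar' : ∀ q ∈ K, r ≤ dist z q := fun q hq => by rw [dist_comm]; exact hKfar q hq
  have hside' : (∀ v ∈ (E δ).zdArcA, 3 * r / 8 ≤ dist (meshPoint (E δ).δ v) z) ∨
      (∀ v ∈ (E δ).zdArcB, 3 * r / 8 ≤ dist (meshPoint (E δ).δ v) z) := by
    rcases hH with hH | hH
    · left
      intro v hv
      have := dist_meshPoint_ge_of_mem_zdDiscreteArc hK hH hzf' (by linarith : r / 4 < r)
        hKfar' hv
      linarith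
    · right
      intro v hv
      have := dist_meshPoint_ge_of_mem_zdDiscreteArc hK hH hzf' (by linarith : r / 4 < r)
        hKfar' hv
      linarith
  have key := arm_of_visit hadm (by rw [hδeq]; exact hδr) hends hside' hρ'r hvisit
  rw [hδeq] at key
  exact key

/-- In `Fin 2`, an index other than `j` is `j + 1`. -/
theorem fin_two_eq_add_one_of_ne : ∀ k j : Fin 2, k ≠ j → k = j + 1 := by decide

/-- In `Fin 2`, `i + 1 ≠ i`. -/
theorem fin_two_add_one_ne : ∀ i : Fin 2, i + 1 ≠ i := by decide

/-- **One visit near an interior point of a boundary arc forces an arm** (family form, the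
shape used below): for `z = D.boundary t₀` with `t₀` strictly inside the parameter interval of
the arc `i`, there is `r > 0` (below the distance from `z` to the other arc) such that for every
`ρ'` with `2ρ' ≤ r/8`, for all small meshes and every configuration whose exploration polygon
visits `B̄(z, ρ')`, `ω` has an open arm in `A(z; ρ' + δ, r/8 - δ)` or a closed arm in
`A(z; ρ' + 3δ, r/8 - 3δ)`. -/
theorem eventually_arm_of_visit (D : DobrushinDomain) {E : ℝ → DiscreteDobrushin}
    (hE : ZdDiscretisationFamily D E) {i : Fin 2} {t₀ : ℝ}
    (ht₀ : t₀ ∈ Ioo (D.mark i) (D.nextMark i)) :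
    ∃ r > 0, ∀ ρ' : ℝ, 2 * ρ' ≤ r / 8 →
      ∀ᶠ δ in 𝓝[>] (0 : ℝ), ∀ ω : BondConfig (Site 2),
        (∃ u, dist (medialExplorationCurve (E δ) ω u) (D.boundary t₀) ≤ ρ') →
          ω ∈ annulusOpenCrossing (D.boundary t₀) δ (ρ' + δ) (r / 8 - δ) ∨
            dualConfig ω ∈
              annulusOpenCrossing (D.boundary t₀) δ (ρ' + 3 * δ) (r / 8 - 3 * δ) := by
  obtain ⟨r, hr, -, hfar⟩ := D.exists_pos_forall_mem_arc_of_dist_lt i ht₀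
  refine ⟨r, hr, fun ρ' hρ'r => ?_⟩
  have hzf : D.boundary t₀ ∈ frontier D.carrier := D.boundary_mem_frontier t₀
  obtain ⟨j, hji⟩ : ∃ j : Fin 2, j ≠ i := ⟨i + 1, fin_two_add_one_ne i⟩
  have hK : (D.arc j).Nonempty := ⟨_, D.pt_mem_arc_self j⟩
  have hKfar : ∀ w ∈ D.arc j, r ≤ dist w (D.boundary t₀) := hfar j hji
  have hpt : ∀ k : Fin 2, r ≤ dist (D.pt k) (D.boundary t₀) := by
    intro k
    refine hKfar _ ?_
    by_cases hkj : k = j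
    · rw [hkj]; exact D.pt_mem_arc_self j
    · rw [fin_two_eq_add_one_of_ne k j hkj]; exact D.pt_succ_mem_arc j
  have hside : Tendsto (fun δ => hausdorffEDist (E δ).arcA (D.arc j)) (𝓝[>] 0) (𝓝 0) ∨
      Tendsto (fun δ => hausdorffEDist (E δ).arcB (D.arc j)) (𝓝[>] 0) (𝓝 0) := by
    fin_cases j
    · exact Or.inl hE.tendsto_arcA
    · exact Or.inr hE.tendsto_arcB
  exact eventually_arm_of_visit_core D hE hzf hr hpt hK hKfar hside hρ'r

end Family

/-! ### Fixed interior points of the boundary arcs are a.s. not on the limit curve -/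

section Limit

/-- The distance from a fixed point to the trace is `1`-Lipschitz on the curve space. -/
theorem infDist_range_le_add_dist (z : ℂ) (γ₁ γ₂ : CurveClass ℂ) :
    infDist z γ₂.range ≤ infDist z γ₁.range + dist γ₁ γ₂ := by
  obtain ⟨c₁, rfl⟩ := CurveClass.surjective_mk γ₁
  obtain ⟨c₂, rfl⟩ := CurveClass.surjective_mk γ₂
  rw [CurveClass.dist_mk_mk, CurveClass.range_mk, CurveClass.range_mk]
  have key : ∀ y ∈ c₁.range, infDist z c₂.range - dist c₁ c₂ ≤ dist z y := by
    rintro _ ⟨t, rfl⟩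
    have h1 : infDist z c₂.range ≤ infDist (c₁ t) c₂.range + dist z (c₁ t) :=
      infDist_le_infDist_add_dist
    have h2 := Curve.infDist_range_le c₁ c₂ t
    linarith
  by_contra h
  push Not at h
  obtain ⟨y, hy, hzy⟩ := (infDist_lt_iff c₁.range_nonempty).1
    (show infDist z c₁.range < infDist z c₂.range - dist c₁ c₂ by linarith)
  have := key y hy
  linarith

/-- Continuity of `γ ↦ infDist z γ.range`. -/
theorem continuous_infDist_range (z : ℂ) : Continuous fun γ : CurveClass ℂ => infDist z γ.range :=
  (LipschitzWith.of_le_add fun γ₂ γ₁ => by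
    rw [dist_comm]; exact infDist_range_le_add_dist z γ₁ γ₂).continuous

/-- **A fixed interior point of a boundary arc is a.s. off the limit curve.** Along positive
meshes `δₙ → 0`, if the interface laws of an admissible `ℤ²`-discretisation family of `(D; a, b)`
converge weakly to `ν`, then for `z = D.boundary t₀`, `t₀` strictly inside the parameter
interval of one of the two arcs, `ν {γ | z ∈ γ.range} = 0`: an interface passing within `2ε` of
`z` produces an open or a closed arm across `A(z; ≈ 2ε, ≈ r/8)` (`eventually_arm_of_visit`), of
probability `≤ 2 (32 ε / r)^α` by the RSW one-arm bounds `annulusOpenCrossing_half_le_holds` /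
`annulusDualCrossing_half_le_holds`; the bound passes to `ν` through the bounded continuous
cut-off `min 1 (max 0 ((2ε - infDist z ·.range)/ε))`, and `ε → 0`. -/
theorem stub_noTrace_fixedPoint :
    ∀ (D : DobrushinDomain) (E : ℝ → DiscreteDobrushin), ZdDiscretisationFamily D E →
      ∀ δs : ℕ → ℝ, (∀ n, 0 < δs n) → Tendsto δs atTop (𝓝 0) →
        ∀ (ν : Measure (CurveClass ℂ)) [IsProbabilityMeasure ν],
          (∀ f : CurveClass ℂ →ᵇ ℝ,
            Tendsto (fun n => ∫ ω, f (bondInterfaceIn D (E (δs n)) ω)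
              ∂(bondPercolation (zdGraph 2) half)) atTop (𝓝 (∫ γ, f γ ∂ν))) →
          ∀ (i : Fin 2) (t₀ : ℝ), t₀ ∈ Set.Ioo (D.mark i) (D.nextMark i) →
            ν {γ | D.boundary t₀ ∈ γ.range} = 0 := by
  intro D E hE δs hpos hlim ν _ hconv i t₀ ht₀
  set z := D.boundary t₀ with hz
  obtain ⟨r, hr, harm⟩ := eventually_arm_of_visit D hE ht₀
  obtain ⟨α, c₀, hα, hc₀, hopen⟩ := annulusOpenCrossing_half_le_holds
  obtain ⟨α', c₀', hα', hc₀', hdual⟩ := annulusDualCrossing_half_le_holds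
  have hδs : Tendsto δs atTop (𝓝[>] 0) :=
    tendsto_nhdsWithin_iff.2 ⟨hlim, Eventually.of_forall hpos⟩
  set b : ℝ → ℝ := fun ε => (32 * ε / r) ^ α + (32 * ε / r) ^ α' with hb
  -- Step 1: for small `ε`, `ν {infDist z range ≤ ε} ≤ b ε`
  have step1 : ∀ ε : ℝ, 0 < ε → 8 * ε ≤ r / 8 →
      ν.real {γ | infDist z γ.range ≤ ε} ≤ b ε := by
    intro ε hε hεr
    -- the cut-off function
    have hcont : Continuous fun γ : CurveClass ℂ =>
        min 1 (max 0 ((2 * ε - infDist z γ.range) / ε)) :=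
      continuous_const.min (continuous_const.max
        ((continuous_const.sub (continuous_infDist_range z)).div_const ε))
    have hbd : ∀ x y : CurveClass ℂ,
        dist ((⟨fun γ => min 1 (max 0 ((2 * ε - infDist z γ.range) / ε)), hcont⟩ :
          C(CurveClass ℂ, ℝ)) x)
          ((⟨fun γ => min 1 (max 0 ((2 * ε - infDist z γ.range) / ε)), hcont⟩ :
          C(CurveClass ℂ, ℝ)) y) ≤ 1 := by
      intro x y
      simp only [ContinuousMap.coe_mk, Real.dist_eq]
      have hx0 : 0 ≤ min 1 (max 0 ((2 * ε - infDist z x.range) / ε)) :=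
        le_min zero_le_one (le_max_left _ _)
      have hx1 : min 1 (max 0 ((2 * ε - infDist z x.range) / ε)) ≤ 1 := min_le_left _ _
      have hy0 : 0 ≤ min 1 (max 0 ((2 * ε - infDist z y.range) / ε)) :=
        le_min zero_le_one (le_max_left _ _)
      have hy1 : min 1 (max 0 ((2 * ε - infDist z y.range) / ε)) ≤ 1 := min_le_left _ _
      exact abs_sub_le_iff.2 ⟨by linarith, by linarith⟩
    set φ : CurveClass ℂ →ᵇ ℝ := BoundedContinuousFunction.mkOfBound
      ⟨fun γ => min 1 (max 0 ((2 * ε - infDist z γ.range) / ε)), hcont⟩ 1 hbd with hφ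
    have hφ_apply : ∀ γ, φ γ = min 1 (max 0 ((2 * ε - infDist z γ.range) / ε)) := fun γ => rfl
    have hφnn : ∀ γ, 0 ≤ φ γ := fun γ => le_min zero_le_one (le_max_left _ _)
    have hφle : ∀ γ, φ γ ≤ 1 := fun γ => min_le_left _ _
    have hφ1 : ∀ γ : CurveClass ℂ, infDist z γ.range ≤ ε → φ γ = 1 := by
      intro γ hγ
      rw [hφ_apply]
      refine min_eq_left (le_max_of_le_right ?_)
      rw [le_div_iff₀ hε]
      linarith
    have hφ0 : ∀ γ : CurveClass ℂ, 0 < φ γ → infDist z γ.range < 2 * ε := by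
      intro γ hγ
      rw [hφ_apply] at hγ
      by_contra h
      push Not at h
      have : (2 * ε - infDist z γ.range) / ε ≤ 0 :=
        div_nonpos_of_nonpos_of_nonneg (by linarith) hε.le
      have : max 0 ((2 * ε - infDist z γ.range) / ε) = 0 := max_eq_left this
      rw [this] at hγ
      simp at hγ
    -- eventually the integrals of `φ ∘ Xₙ` are at most `b ε`
    have hev : ∀ᶠ n in atTop,
        ∫ ω, φ (bondInterfaceIn D (E (δs n)) ω) ∂(bondPercolation (zdGraph 2) half) ≤ b ε := by
      have hA := hδs.eventually (harm (2 * ε) (by linarith))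
      have hs1 : ∀ᶠ n in atTop, δs n ≤ ε / 3 := hlim.eventually (Iic_mem_nhds (by positivity))
      have hs2 : ∀ᶠ n in atTop, δs n ≤ r / 96 := hlim.eventually (Iic_mem_nhds (by positivity))
      have hs3 : ∀ᶠ n in atTop, c₀ * δs n ≤ ε := by
        have := hlim.const_mul c₀
        rw [mul_zero] at this
        exact this.eventually (Iic_mem_nhds hε)
      have hs4 : ∀ᶠ n in atTop, c₀' * δs n ≤ ε := by
        have := hlim.const_mul c₀'
        rw [mul_zero] at this
        exact this.eventually (Iic_mem_nhds hε)
      filter_upwards [hA, hs1, hs2, hs3, hs4] with n hA h1 h2 h3 h4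
      set δ := δs n with hδn
      have hδ : 0 < δ := hpos n
      set P := bondPercolation (zdGraph 2) half with hP
      set A₁ := annulusOpenCrossing z δ (2 * ε + δ) (r / 8 - δ) with hA₁
      set A₂ := annulusDualCrossing z δ (2 * ε + 3 * δ) (r / 8 - 3 * δ) with hA₂
      have hmeas : MeasurableSet (A₁ ∪ A₂) :=
        (measurableSet_annulusOpenCrossing hδ z _ _).union
          (measurable_dualConfig (measurableSet_annulusOpenCrossing hδ z _ _))
      -- pointwise domination by the indicator of the arm events
      have hptw : ∀ ω, φ (bondInterfaceIn D (E δ) ω) ≤ (A₁ ∪ A₂).indicator 1 ω := by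
        intro ω
        by_cases hω : ω ∈ A₁ ∪ A₂
        · rw [indicator_of_mem hω]; exact hφle _
        · rw [indicator_of_notMem hω]
          by_contra hlt
          push Not at hlt
          have hlt2 := hφ0 _ hlt
          rw [range_bondInterfaceIn] at hlt2
          obtain ⟨_, ⟨u, rfl⟩, hy⟩ := (infDist_lt_iff (Set.range_nonempty _)).1 hlt2
          refine hω (hA ω ⟨u, ?_⟩)
          rw [dist_comm]; exact hy.le
      -- the two RSW bounds
      have hb1 : P.real A₁ ≤ (32 * ε / r) ^ α := by
        refine (hopen z δ (2 * ε + δ) (r / 8 - δ) hδ (by linarith) (by linarith)).trans ?_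
        refine Real.rpow_le_rpow (div_nonneg (by linarith) (by linarith)) ?_ hα.le
        rw [div_le_div_iff₀ (by linarith) hr]
        nlinarith
      have hb2 : P.real A₂ ≤ (32 * ε / r) ^ α' := by
        refine (hdual z δ (2 * ε + 3 * δ) (r / 8 - 3 * δ) hδ (by linarith) (by linarith)).trans ?_
        refine Real.rpow_le_rpow (div_nonneg (by linarith) (by linarith)) ?_ hα'.le
        rw [div_le_div_iff₀ (by linarith) hr]
        nlinarith
      calc ∫ ω, φ (bondInterfaceIn D (E δ) ω) ∂P
          ≤ ∫ ω, (A₁ ∪ A₂).indicator 1 ω ∂P :=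
            integral_mono_of_nonneg (Eventually.of_forall fun ω => hφnn _)
              ((integrable_const (1 : ℝ)).indicator hmeas) (Eventually.of_forall hptw)
        _ = P.real (A₁ ∪ A₂) := integral_indicator_one hmeas
        _ ≤ P.real A₁ + P.real A₂ := measureReal_union_le _ _
        _ ≤ b ε := add_le_add hb1 hb2
    -- pass to the limit
    have hlimφ : ∫ γ, φ γ ∂ν ≤ b ε := le_of_tendsto (hconv φ) hev
    have hmeasF : MeasurableSet {γ : CurveClass ℂ | infDist z γ.range ≤ ε} :=
      (isClosed_le (continuous_infDist_range z) continuous_const).measurableSet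
    calc ν.real {γ | infDist z γ.range ≤ ε}
        = ∫ γ, {γ : CurveClass ℂ | infDist z γ.range ≤ ε}.indicator 1 γ ∂ν :=
          (integral_indicator_one hmeasF).symm
      _ ≤ ∫ γ, φ γ ∂ν := by
          refine integral_mono ((integrable_const (1 : ℝ)).indicator hmeasF) (φ.integrable ν)
            fun γ => ?_
          by_cases hγ : γ ∈ {γ : CurveClass ℂ | infDist z γ.range ≤ ε}
          · rw [indicator_of_mem hγ, hφ1 γ hγ]; simp
          · rw [indicator_of_notMem hγ]; exact hφnn γ
      _ ≤ b ε := hlimφ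
  -- Step 2: `b ε → 0`, and `{z ∈ range} ⊆ {infDist z range ≤ ε}`
  have hb0 : Tendsto b (𝓝[>] 0) (𝓝 0) := by
    have hlin : Tendsto (fun ε : ℝ => 32 * ε / r) (𝓝 0) (𝓝 0) := by
      have : Continuous fun ε : ℝ => 32 * ε / r := by fun_prop
      simpa using this.tendsto 0
    have h1 := hlin.rpow_const_nhds_zero hα
    have h2 := hlin.rpow_const_nhds_zero hα'
    have := h1.add h2
    rw [add_zero] at this
    exact tendsto_nhdsWithin_of_tendsto_nhds this
  have hsmall : ∀ᶠ ε in 𝓝[>] (0 : ℝ), 0 < ε ∧ 8 * ε ≤ r / 8 := by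
    have h1 : ∀ᶠ ε in 𝓝[>] (0 : ℝ), 0 < ε := eventually_mem_nhdsWithin
    have h2 : ∀ᶠ ε in 𝓝[>] (0 : ℝ), ε ≤ r / 64 :=
      mem_nhdsWithin_of_mem_nhds (Iic_mem_nhds (by positivity))
    filter_upwards [h1, h2] with ε h1 h2
    exact ⟨h1, by linarith⟩
  have hle : ∀ᶠ ε in 𝓝[>] (0 : ℝ), ν {γ | z ∈ γ.range} ≤ ENNReal.ofReal (b ε) := by
    filter_upwards [hsmall] with ε ⟨hε, hεr⟩
    calc ν {γ | z ∈ γ.range} ≤ ν {γ | infDist z γ.range ≤ ε} := by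
          refine measure_mono fun γ hγ => ?_
          show infDist z γ.range ≤ ε
          rw [infDist_zero_of_mem (show z ∈ γ.range from hγ)]; exact hε.le
      _ = ENNReal.ofReal (ν.real {γ | infDist z γ.range ≤ ε}) :=
          (ofReal_measureReal (measure_ne_top _ _)).symm
      _ ≤ ENNReal.ofReal (b ε) := ENNReal.ofReal_le_ofReal (step1 ε hε hεr)
  have hlim0 : Tendsto (fun ε => ENNReal.ofReal (b ε)) (𝓝[>] 0) (𝓝 0) := by
    rw [← ENNReal.ofReal_zero]
    exact ENNReal.tendsto_ofReal hb0
  exact nonpos_iff_eq_zero.1 (ge_of_tendsto hlim0 hle)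


/-- `stub_noTrace_fixedPoint` with implicit arguments. -/
theorem measure_boundary_mem_range_eq_zero (D : DobrushinDomain) {E : ℝ → DiscreteDobrushin}
    (hE : ZdDiscretisationFamily D E) {δs : ℕ → ℝ} (hpos : ∀ n, 0 < δs n)
    (hlim : Tendsto δs atTop (𝓝 0)) (ν : Measure (CurveClass ℂ)) [IsProbabilityMeasure ν]
    (hconv : ∀ f : CurveClass ℂ →ᵇ ℝ,
      Tendsto (fun n => ∫ ω, f (bondInterfaceIn D (E (δs n)) ω)
        ∂(bondPercolation (zdGraph 2) half)) atTop (𝓝 (∫ γ, f γ ∂ν)))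
    {i : Fin 2} {t₀ : ℝ} (ht₀ : t₀ ∈ Ioo (D.mark i) (D.nextMark i)) :
    ν {γ | D.boundary t₀ ∈ γ.range} = 0 :=
  stub_noTrace_fixedPoint D E hE δs hpos hlim ν hconv i t₀ ht₀

end Limit

end Summit.CriticalPhenomena.CardyFormulaZ2.Cruxes.LagHandOff.HittingTournament

end
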